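import Literature.AlgebraicGeometry.HodgeTheory.WeilClassesCMReductionHyperbolic
import Literature.AlgebraicGeometry.HodgeTheory.MotivatedClassesTransport
import Literature.AlgebraicGeometry.Deligne1982.WeilTypeCMIsogeny
import Literature.AlgebraicGeometry.Motives.TateAbelianFiniteLatticeProofs
import Literature.AlgebraicGeometry.Motives.AimedSplitProductProofs
import Summits.HodgeConjecture.HodgeConjecture.Theorems.Ring2AbelianAllWeilHyperbolicDescent
import Summits.HodgeConjecture.HodgeConjecture.Theorems.Ring2AbelianAllAndreWeilFieldDiscriminantTransport
import HarnessLib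

/-!
# BiquadraticSecantLift · X2 — `IsHyperbolicWeilTypeCM` is invariant under equivariant isomorphisms

Helper file for crux X2 `BiquadraticBaseChangeHyperbolic` (stmt-HodgeConjecture-22133) of
route-HodgeConjecture-BiquadraticSecantLift. For an isomorphism of abelian varieties `e : B' ≅ B` with
`η' ≫ e.hom = e.hom ≫ η`, the predicate `IsHyperbolicWeilTypeCM B η R e₀ k` (Weil type relative to the CM field
`ℚ[T]/(R(T²))`, a polarization class whose Rosati involution is complex conjugation, split Deligne discriminant, and an
`η^*`-stable rational Lagrangian) transfers to `(B', η')` with the class `e^* h`: Weil type along the isogeny `e.hom`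
(`IsWeilTypeCM.of_isIsogeny'`), the polarization class (`IsPolarizationClass.map_of_iso`), the Rosati condition and the
discriminant witness (`hasWeilDiscriminantCM_of_transport`, `e^*` bijective on `H¹` and on the top pairing degree,
`e^* Q_h(x, y) = Q_{e^*h}(e^*x, e^*y)`), and the Lagrangian (`isHyperbolicWeilType_comap_of_comm`). Used to pass from
`⨁_{Fin 2} A` to the route's `A ⊞ A`.

Nothing here is a case of the Hodge conjecture (HC is NOT proved; X2 is not proved by this file).

## References
[cite: Deligne1982HodgeCycles, §4 p. 30, Cor. 4.2, Lemma 4.6] [cite: vanGeemen1994HodgeAV, Lemma 5.2 (3)]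
-/

-- every declaration of this problem lives in `Summit.HodgeConjecture.HodgeConjecture.…` (summit = sub-problem)
set_option linter.dupNamespace false

noncomputable section

open CategoryTheory Polynomial Module
open Literature.AlgebraicTopology.SingularHomology
open Literature.AlgebraicGeometry.HodgeTheory
open Literature.AlgebraicGeometry.Motives (AbelianVariety IsSmoothProjective polarizationPairingOne map_polarizationPairingOne)
open Literature.AlgebraicGeometry.Motives.AbelianVariety (IsIsogeny isIsogeny_id isIsogeny_of_comp_eq_of_comp_eq dim_eq_of_isIsogeny)
open Literature.AlgebraicGeometry.VanGeemen1994 (pullbackOne)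
open Literature.AlgebraicGeometry.Deligne1982
open Summit.HodgeConjecture.HodgeConjecture.Ring2.AbelianAll (hasWeilDiscriminantCM_of_transport isHyperbolicWeilType_comap_of_comm)

namespace Summit.HodgeConjecture.HodgeConjecture.BiquadraticSecantLift

/-- An isomorphism of abelian varieties is an isogeny. -/
theorem isIsogeny_hom_of_iso {B B' : AbelianVariety ℂ} (e : B' ≅ B) : IsIsogeny e.hom :=
  isIsogeny_of_comp_eq_of_comp_eq (isIsogeny_id B) (isIsogeny_id B') e.inv_hom_id e.hom_inv_id

/-- **`IsHyperbolicWeilTypeCM` transfers along an equivariant isomorphism `e : B' ≅ B`** (`η' ≫ e.hom = e.hom ≫ η`),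
with the polarization class `e^* h`. -/
theorem isHyperbolicWeilTypeCM_of_iso {B B' : AbelianVariety ℂ} {η : B ⟶ B} {η' : B' ⟶ B'} (e : B' ≅ B)
    (hcomm : η' ≫ e.hom = e.hom ≫ η) {R : Polynomial ℤ} {e₀ k : ℕ} (hB : IsHyperbolicWeilTypeCM B η R e₀ k) :
    IsHyperbolicWeilTypeCM B' η' R e₀ k := by
  obtain ⟨hW, h, hpol, hros, hdisc, hhyp⟩ := hB
  haveI := hW.fact_irreducible_map_real
  have hiso : IsIsogeny e.hom := isIsogeny_hom_of_iso e
  have hW' : IsWeilTypeCM B' η' R e₀ k := hW.of_isIsogeny' hiso hcomm.symm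
  have hdim : B'.dim = B.dim := dim_eq_of_isIsogeny hiso
  have hXB : IsSmoothProjective B.dim B.X := Literature.AlgebraicGeometry.Motives.AbelianVariety.isSmoothProjective_holds
  have hXB' : IsSmoothProjective B'.dim B'.X := Literature.AlgebraicGeometry.Motives.AbelianVariety.isSmoothProjective_holds
  -- the isomorphism of underlying schemes
  let eX : B'.X ≅ B.X :=
    { hom := e.hom.hom.hom.hom
      inv := e.inv.hom.hom.hom
      hom_inv_id := by
        change (e.hom ≫ e.inv).hom.hom.hom = (𝟙 B' : B' ⟶ B').hom.hom.hom
        rw [e.hom_inv_id]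
      inv_hom_id := by
        change (e.inv ≫ e.hom).hom.hom.hom = (𝟙 B : B ⟶ B).hom.hom.hom
        rw [e.inv_hom_id] }
  have hehom : eX.hom = e.hom.hom.hom.hom := rfl
  -- `e^*` is bijective on every cohomology group
  have hbij : ∀ i, Function.Bijective (complexBetti.map e.hom.hom.hom.hom i) := fun i ↦ by
    rw [← hehom]; exact complexBetti.bijective_map_of_iso eX i
  -- intertwining and compatibility with the pairings
  have hTφ : ∀ x : complexBetti B.X 1, complexBetti.map e.hom.hom.hom.hom 1 (complexBetti.map η.hom.hom.hom 1 x) =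
      complexBetti.map η'.hom.hom.hom 1 (complexBetti.map e.hom.hom.hom.hom 1 x) := fun x ↦ by
    rw [complexBetti_map_map_hom, complexBetti_map_map_hom, hcomm]
  have hTQ : ∀ x y : complexBetti B.X 1, complexBetti.map e.hom.hom.hom.hom (2 + 2 * (B.dim - 1))
      (polarizationPairingOne B.X h (B.dim - 1) x y) =
      polarizationPairingOne B'.X (complexBetti.map e.hom.hom.hom.hom 2 h) (B.dim - 1)
        (complexBetti.map e.hom.hom.hom.hom 1 x) (complexBetti.map e.hom.hom.hom.hom 1 y) :=
    fun x y ↦ map_polarizationPairingOne _ h _ x y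
  refine ⟨hW', complexBetti.map e.hom.hom.hom.hom 2 h, ?_, ?_, ?_, ?_⟩
  · -- polarization class (stated at `dim B'`, proved at `dim B`)
    have key : ∀ n, n = B.dim → IsPolarizationClass n B'.X (complexBetti.map e.hom.hom.hom.hom 2 h) := by
      rintro n rfl
      rw [← hehom]
      exact hpol.map_of_iso hXB hXB' eX
    exact key _ hdim
  · -- Rosati: `Q_{e^*h}(η'^* x', y') = -Q_{e^*h}(x', η'^* y')`
    have key : ∀ n, n = B.dim → ∀ x' y' : complexBetti B'.X 1,
        polarizationPairingOne B'.X (complexBetti.map e.hom.hom.hom.hom 2 h) (n - 1) (pullbackOne B' η' x') y' =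
          -polarizationPairingOne B'.X (complexBetti.map e.hom.hom.hom.hom 2 h) (n - 1) x' (pullbackOne B' η' y') := by
      rintro n rfl x' y'
      obtain ⟨x, rfl⟩ := (hbij 1).2 x'
      obtain ⟨y, rfl⟩ := (hbij 1).2 y'
      change polarizationPairingOne B'.X _ (B.dim - 1)
          (complexBetti.map η'.hom.hom.hom 1 (complexBetti.map e.hom.hom.hom.hom 1 x)) _ =
        -polarizationPairingOne B'.X _ (B.dim - 1) _
          (complexBetti.map η'.hom.hom.hom 1 (complexBetti.map e.hom.hom.hom.hom 1 y))
      rw [← hTφ, ← hTφ, ← hTQ, ← hTQ, ← map_neg]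
      exact congrArg _ (hros x y)
    exact key _ hdim
  · -- the discriminant witness rides along `e^*`
    exact hasWeilDiscriminantCM_of_transport (η := η) (ψ := η') rfl hdim
      (complexBetti.map e.hom.hom.hom.hom 1).hom (complexBetti.map e.hom.hom.hom.hom (2 + 2 * (B.dim - 1))).hom
      (hbij 1).1 (hbij _).1 (fun x hx ↦ isRationalClass_complexBetti_map _ hx)
      (fun ω hω ↦ isRationalClass_complexBetti_map _ hω) hTφ hTQ hdisc
  · -- the Lagrangian
    exact isHyperbolicWeilType_comap_of_comm e.hom hcomm.symm (hbij 1).1 hhyp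

end Summit.HodgeConjecture.HodgeConjecture.BiquadraticSecantLift
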